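import Summits.ResolutionOfSingularities.ResolutionOfSingularities.Theorems.FrobeniusClosingPatchingRelPerfectDepthPhaseCAtlasP
import Summits.ResolutionOfSingularities.ResolutionOfSingularities.Theorems.FrobeniusClosingPatchingRelPerfectDepthTargetsDefs
import Literature.AlgebraicGeometry.Resolution.BlowupReducedDimension
import HarnessLib

/-!
# Crux `PatchingRelPerfect` (stmt-ResolutionOfSingularities-16161), chain W5.2 — F7(β) (β-AX) X3 C-I: the DIMENSION clause of the pole
# atlas — reachable ambient schemes have dimension ≤ 4 (K21)

[OURS · L1 W5.2 · F7(β) (β-AX) X3 C-I · res-L1-w52-plan-1 NAMING G12-40 (2) / NOTE G12-46 (2) (hand res-D-pv-021 g9; K21 = res-L1-repro-3΄s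
dimension binder); pattern of `…DepthPhaseCReachBasic` §0.]  Replaces the role of NO printed item; NOT a statement of the manuscript under
review; fact-free.  AI-written; AI review is weaker than expert review.  No definitions.

* `atlasInitial_krullDimLE_four` — generation zero: `InitialShape` makes `X` a blowing up of `Spec S` (`DepthInvariant.exists_isBlowup_supported`)
  with `dim S = 4`, and blowing up a locally Noetherian scheme does not raise the dimension
  (`IsBlowup.topologicalKrullDim_le_of_isLocallyNoetherian`, Matsumura 15.5 / CJS 3.10).
* `stepStable_krullDimLE_four` — the lifted cylinder step is a blowing up `τ`: the same lemma.
* **`CylReach.krullDimLE_four (h : CylReach S cyl) : topologicalKrullDim X ≤ 4`** — the dimension binder of repro-3΄s contact-surface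
  assembly (`ContactCure₂`), read off `CylReach` since lead-1΄s interface `hCure` carries no dimension.

## References
* H. Matsumura, *Commutative Ring Theory* (1987), Thm. 15.5 (dimension formula / inequality). [Matsumura1987]
* V. Cossart, U. Jannsen, S. Saito (2020), Thm. 3.10 (proof: blow-ups do not raise dimension). [CossartJannsenSaito2020]
-/

-- `Summit.<Summit>.<Sub>.Theorems` with `Sub = Summit` (single-conjunct summit, D-0017)
set_option linter.dupNamespace false

noncomputable section

open CategoryTheory AlgebraicGeometry TopologicalSpace IsLocalRing
open Literature.AlgebraicGeometry.Resolution
open Scheme.IdealSheafData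

namespace Summit.ResolutionOfSingularities.ResolutionOfSingularities.Theorems

universe u

namespace ChainW52F7BetaRP

open DepthMultiHost DepthTargets

/-- [OURS · L1 W5.2] **Generation zero has dimension ≤ 4**: by `InitialShape`, `X` is a blowing up of `Spec S` with `dim S = 4`, and blowing up
does not raise the dimension. [cite: Matsumura1987, Thm. 15.5] [cite: CossartJannsenSaito2020, Thm. 3.10 (proof)] -/
theorem atlasInitial_krullDimLE_four : AtlasInitial (fun X _ _ => topologicalKrullDim X ≤ 4) := by
  intro X _ St cyl _ _ hV hZreg hZexc hZdim h𝓔 hXexc hn hshape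
  obtain ⟨R, _, _, _, hdim, _, _, _, _, _, _, _, _, _, _, g, i, hinv, -⟩ := hshape
  obtain ⟨K₀, hg, -⟩ := hinv.exists_isBlowup_supported
  refine hg.topologicalKrullDim_le_of_isLocallyNoetherian (n := 4) ?_
  change topologicalKrullDim (PrimeSpectrum R) ≤ (4 : ℕ)
  rw [PrimeSpectrum.topologicalKrullDim_eq_ringKrullDim, hdim]

/-- [OURS · L1 W5.2] **Dimension ≤ 4 is step-stable**: the lifted cylinder step is a blowing up. [cite: Matsumura1987, Thm. 15.5] -/
theorem stepStable_krullDimLE_four : StepStable (fun X _ _ => topologicalKrullDim X ≤ 4) := by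
  intro X X' _ _ S cyl _ _ C hC0 hCreg hCrad 𝓑 h𝓑 h𝓑C D hD hsub hBsing hperm τ hτ η hη m hm hm' hsncX cyl' τZ hτZ hsq hker htr
    hbd hbdF hV' hlow h
  exact hτ.topologicalKrullDim_le_of_isLocallyNoetherian (n := 4) h

/-- [OURS · L1 W5.2] **REACHABLE AMBIENT SCHEMES HAVE DIMENSION ≤ 4** (K21, the dimension binder of the contact-surface assembly).
[cite: Matsumura1987, Thm. 15.5] [cite: CossartJannsenSaito2020, Thm. 3.10 (proof)] -/
theorem CylReach.krullDimLE_four {X : Scheme.{u}} {S : MultiHostState X} {cyl : CylState S} (h : CylReach S cyl) :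
    topologicalKrullDim X ≤ 4 :=
  h.induct stepStable_krullDimLE_four atlasInitial_krullDimLE_four

end ChainW52F7BetaRP

end Summit.ResolutionOfSingularities.ResolutionOfSingularities.Theorems

end
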